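import Summits.QuantumFields.YangMills.Theorems.BalabanUVNodesN11NoExpansionGeneralStepGraph
import Summits.QuantumFields.YangMills.Theorems.BalabanUVNodesN11RePinnedParamDefs
import Literature.MathematicalPhysics.QuantumFieldTheory.Balaban1983to89.Node00.Record12LocalLawsTwoScale

/-!
# DAG node N11 — THE OLD-BRANCH AND RE-PINNED FORMS OF THE NO-EXPANSION 𝐓-STEP UNDER INTEGRABILITY OF THE OLD BRANCHES ALONE (R4b ∕ p553094 §3 ∕ p569094 of
# g9 with the measurability binders `hm` ∕ `hmB` DROPPED — door (d2) closed)

HEADER — WORK-UNIT METADATA.  Cell `pub-ymgap`, YM-PLAN Track A (HUMAN RULING D-0062), seat `pub-ymgap-dag-n11-d` (g10; R134 fan-out seat N11 [B14], strategy s2),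
route `BalabanUVNodes` rev 25, item K1⁷ `StabilityBAtRecordR13SepCoPH` = stmt-QuantumFields-20542 (helper, `--kind proof --supports 20542 --as helper`, count-neutral).
[III] = [Balaban1988Convergent], [IV] = [Balaban1989LargeFieldI].  Over this seat's g10 `…N11NoExpansionGeneralStepGraph` (R3′∕R4a′), g9 R4b `…N11NoExpansionOldBranchIntegrable`
(p563293), A2 `…N11RePinnedParamDefs` (p552185: `rePinH θ` and its pin faces), D `…N11NoExpansionGeneralStepRePinnedIntegrable` (p569094).

WHY THIS FILE.  Third link of door (d2).  Referee READ-733 on p569094: the off-diagonal residue of N11's no-expansion 𝐓-step is {hA, hΦm, hIB}.  `hΦm` (operand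
measurability) served only `hmB` (old-branch measurability, C3), which served only the joint measurability `hm` of the new integrand (p563293 §3's first bullet),
which served only the a.e.-strong measurability of that integrand on the joint law of `(Ū₀, U₀)` — and THAT is part of the integrability binder `hI`, because the
joint law is carried by the averaging graph (`…TkFullBondTransportGraph` §0).  So `hΦm`∕`hmB`∕`hm` are DROPPED all the way up: here for R4b's clause-keyed,
provisos-keyed and old-branch forms and for the `rePinH θ` face of p569094.  With the sibling `…N11FluctTruncation` ((hA) eliminated per witness) the residue is
{hIB}: INTEGRABILITY OF THE OLD BRANCHES OF THE `SLaw` WITNESS — nothing else.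

WHAT THIS FILE PROVES (0 `sorry`, 0 `def`; generic `θ : Stage13HParams`).
§1 (R4b′) `clause_succ_CoPH_of_Omega_empty_of_pinChi_of_clause_of_graph`, `…_of_pinChi_of_provisos_of_clause_of_graph`.
§2 ★★ `clause_succ_CoPH_of_Omega_empty_of_pinChi_of_oldBranch_of_clause_of_graph` (old-branch form: `hIB` alone).
§3 ★★★ `clause_succ_rePinH_of_Omega_empty_of_oldBranch_of_clause_of_graph` (p569094's first theorem with `hmB` dropped: binders `hA`, `hIB`).

HONEST FRAMING.  Helper lane of K1⁷; kernel bookkeeping; nothing of Bałaban's is asserted; no accepted theorem is edited.  No `∃`-form with binders over «all term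
families» is stated (vacuity species, see `…N11FluctTruncation`'s header); the per-witness `SLaw`-keyed form with the residue {hIB} is the sibling's §4.  N11 NOT
discharged; K1⁷ NOT closed; counts unmoved (typed 28∕28 · discharged 5∕27).  One finite four-torus programme at fixed `ε = L^{−K}` — NOT ℝ⁴, NOT OS, NOT a mass gap,
NOT Clay.  No `sorry`, `axiom`, `instance`, `notation`.
Sources (SHAPE only): [III] Theorem p.245, (2.18) p.257, (2.20)–(2.25) pp.258–259, (3.2)–(3.9) pp.265–266, (3.16) p.268, (3.24)–(3.25) p.270; [IV] (0.2)–(0.3) p.176.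
-/

noncomputable section

open MeasureTheory
open scoped BigOperators Matrix.Norms.L2Operator

namespace Summit.QuantumFields.YangMills.Theorems.BalabanUVNodesN11NoExpansionOldBranchGraph

open Literature.MathematicalPhysics.QuantumFieldTheory.Balaban1983to89 T4Continuum Node00 Node00.Tk DagBinding
open B15DeterminingSets
open BalabanUVNodesN11NoExpansionGeneralStepGraph (clause_succ_of_Omega_empty_of_prefix_of_clause_of_graph)
open BalabanUVNodesN11NoExpansionOldFactors (oldFactors_agree_of_Omega_empty)
open BalabanUVNodesN11TkBranchWeightCongr (sect2Slot_congr_of_weights tkWeightsOfRecordP_ζ_congr tkWeightsOfRecordP_w_congr)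
open BalabanUVNodesN11NoExpansionDiagonalAtZ (tkWeightsOfRecordP_ζ_apply tkWeightsOfRecordP_w_empty tkWeightsOfRecordP_ζ_local)
open BalabanUVNodesN11NoExpansionDiagonalCoPH (WtOfRecord₁₃H_eq_tkWeightsOfRecordP)
open BalabanUVNodesN11NoExpansionGeneralStepCoPH (tkWeightsOfRecordP_w_local_of_quad_local)
open BalabanUVNodesN11NoExpansionGeneralStepCoPHOldBranch (newIntegrand_eq_of_pinChi measurable_chiSeqOfRecord_init)
open BalabanUVNodesN11RePinnedParamDefs

variable {F : T4Family} {N : ℕ} [NeZero N]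

/-! ## §1  R4b′ — the v1.7 record, clause-keyed and provisos-keyed, graph-integrable, no measurability binder -/

section CoPH

variable (θ : Stage13HParams F N) (p : B12.RunParams)

/-- **★★ THE NO-EXPANSION 𝐓-STEP AFTER AN ARBITRARY HISTORY AT THE v1.7 `CoPH` RECORD, CLAUSE-KEYED, GENERIC `θ : Stage13HParams`.**  See the module header:
`hid` at `init s′` (history's residual and weights of `init s′`) ⇒ the 𝐓-image clause at `s′` (history's residual and weights of `s′`), same `t`, same `E₀`, under
(P) `hpre`, (V) `hZ` + `hq`, locality `hloc` ∕ `hqloc` ∕ `hA`, and graph-integrability `hI` (p563293's `hm` DROPPED). [cite: Balaban1988Convergent, Theorem p.245, (3.24)–(3.25) p.270, (2.18) p.257, (2.20)–(2.25) pp.258–259, (3.16) p.268; Balaban1989LargeFieldI, (0.2)–(0.3) p.176] -/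
theorem clause_succ_CoPH_of_Omega_empty_of_pinChi_of_clause_of_graph {k : ℕ} (hk : k < p.K) (hM : 1 ≤ θ.τ9.M)
    (s : SeqOfRecord F θ.ν θ.τ9.M (gOfRecord₁₃ F N θ.toStage13Params p) p.K (k + 1)) (hΩ : s.Ω (k + 1) = ∅)
    (hloc : (θ.zhAt p s).LocalLaws)
    (hqloc : ∀ j, j < k → ∀ ω ω' : MultiCfg (F.P p.K) (SU N) (FluctV N), (∀ i, i ≤ k → ω i = ω' i) →
      (θ.zhAt p s).quad j (s.init.Λ (j + 1)) ω = (θ.zhAt p s).quad j (s.init.Λ (j + 1)) ω')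
    (hpre : ∀ j, j < k → (θ.zhAt p s).ζ0 j = (θ.zhAt p s.init).ζ0 j ∧ (θ.zhAt p s).quad j = (θ.zhAt p s.init).quad j)
    (t : Sect2.TermValues (F.P p.K) (MatA N) (FluctV N) θ.τ9.M) (E₀ : ℝ)
    (hA : ∀ (S : ℕ → Set (Site (F.P p.K) 0)) (a a' : Tk.MSFluct (F.P p.K) (FluctV N)) (Uf : GaugeField (F.P p.K) 0 (SU N)), (∀ i, i ≤ k → a i = a' i) →
      (sect2ActionDataOfRecord F N (FluctV N) p.K (settingOfRecord₁₃ F N θ.toStage13Params p) (θ.rzAt p s.init) s.init t (S, a) E₀).action23 k Uf =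
        (sect2ActionDataOfRecord F N (FluctV N) p.K (settingOfRecord₁₃ F N θ.toStage13Params p) (θ.rzAt p s.init) s.init t (S, a') E₀).action23 k Uf)
    (hid : slotsOfRecord F N θ.ν θ.τ9 (EOfRecord₁₃ F N θ.toStage13Params) (wOfRecord₉ F N θ.toStage9Params) θ.ppSel p
        (gOfRecord₁₃ F N θ.toStage13Params p) k s.init = 0 ∨
      ∀ᵐ U₀ ∂fieldMeasure (F.P p.K) k (SU N),
        chiSeqOfRecord F N θ.ν θ.τ9.M (gOfRecord₁₃ F N θ.toStage13Params p) p.K k s.init U₀ ≠ 0 →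
          slotsOfRecord F N θ.ν θ.τ9 (EOfRecord₁₃ F N θ.toStage13Params) (wOfRecord₉ F N θ.toStage9Params) θ.ppSel p
              (gOfRecord₁₃ F N θ.toStage13Params p) k s.init U₀ =
            sect2Slot F N (FluctV N) p.K (settingOfRecord₁₃ F N θ.toStage13Params p) (θ.rzAt p s.init) (WtOfRecord₁₃H F N θ p s.init) s.init t E₀
              (UbgOfRecord₁₃CoP F N θ.toStage13Params p k s.init) U₀)
    (hZ : ∀ (V' : GaugeField (F.P p.K) (k + 1) (SU N)) (U₀ : GaugeField (F.P p.K) k (SU N)),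
      (θ.zhAt p s).ζ0 k Set.univ (pairCfgAt (V := FluctV N) k V' U₀) =
        chiSeqOfRecord F N θ.ν θ.τ9.M (gOfRecord₁₃ F N θ.toStage13Params p) p.K k s.init U₀ *
          wOfRecord₉ F N θ.toStage9Params p (gOfRecord₁₃ F N θ.toStage13Params p) k s U₀ ((avOfRecord F N p.K k).avg U₀))
    (hq : ∀ (V' : GaugeField (F.P p.K) (k + 1) (SU N)) (U₀ : GaugeField (F.P p.K) k (SU N)), (θ.zhAt p s).quad k ∅ (pairCfgAt (V := FluctV N) k V' U₀) = 0)
    (hI : ∀ S ∈ admSOfRecord F θ.ν θ.τ9.M (gOfRecord₁₃ F N θ.toStage13Params p) p.K k s.init,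
      Integrable (fun U₀ : GaugeField (F.P p.K) k (SU N) => noExpIntegrandAt F N (FluctV N) p.K k (WtOfRecord₁₃H F N θ p s)
        (tkBranchOfRecord F N (FluctV N) θ.ν θ.τ9.M _ p.K (WtOfRecord₁₃H F N θ p s) s.init S k
          (fun ω => sect2Operand F N (FluctV N) p.K (settingOfRecord₁₃ F N θ.toStage13Params p) (θ.rzAt p s) s t E₀
            (UbgOfRecord₁₃CoP F N θ.toStage13Params p (k + 1) s) (S, fun j => (ω j).2) (fun j => (ω j).1)))
        ((avOfRecord F N p.K k).avg U₀) U₀) (fieldMeasure (F.P p.K) k (SU N))) :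
    slotsTOfRecord F N θ.ν θ.τ9 (EOfRecord₁₃ F N θ.toStage13Params) (wOfRecord₉ F N θ.toStage9Params) θ.ppSel p
        (gOfRecord₁₃ F N θ.toStage13Params p) (k + 1) s = 0 ∨
      ∀ᵐ V' ∂fieldMeasure (F.P p.K) (k + 1) (SU N),
        chiSeqOfRecord F N θ.ν θ.τ9.M (gOfRecord₁₃ F N θ.toStage13Params p) p.K (k + 1) s V' ≠ 0 →
          slotsTOfRecord F N θ.ν θ.τ9 (EOfRecord₁₃ F N θ.toStage13Params) (wOfRecord₉ F N θ.toStage9Params) θ.ppSel p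
              (gOfRecord₁₃ F N θ.toStage13Params p) (k + 1) s V' =
            sect2Slot F N (FluctV N) p.K (settingOfRecord₁₃ F N θ.toStage13Params p) (θ.rzAt p s) (WtOfRecord₁₃H F N θ p s) s t E₀
              (UbgOfRecord₁₃CoP F N θ.toStage13Params p (k + 1) s) V' := by
  -- (P) at the level of 12a″'s weights: prefix agreement of `ζ_j`, `w_j`, `j < k`
  have hpre' : ∀ j, j < k → (WtOfRecord₁₃H F N θ p s).ζ j = (WtOfRecord₁₃H F N θ p s.init).ζ j ∧
      (WtOfRecord₁₃H F N θ p s).w j = (WtOfRecord₁₃H F N θ p s.init).w j := fun j hj =>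
    ⟨tkWeightsOfRecordP_ζ_congr θ.ν θ.A₁ p (gOfRecord₁₃ F N θ.toStage13Params p) (θ.zhAt p s) (θ.zhAt p s.init) j (hpre j hj).1,
      tkWeightsOfRecordP_w_congr θ.ν θ.A₁ p (gOfRecord₁₃ F N θ.toStage13Params p) (θ.zhAt p s) (θ.zhAt p s.init) j (hpre j hj).2⟩
  -- 12b locality of the history's residual ⇒ `k`-locality of `ζ_j`, `j < k`
  have hζloc : ∀ j, j < k → ∀ ω ω' : MultiCfg (F.P p.K) (SU N) (FluctV N), (∀ i, i ≤ k → ω i = ω' i) →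
      (WtOfRecord₁₃H F N θ p s).ζ j (s.init.Ω (j + 1))ᶜ ω = (WtOfRecord₁₃H F N θ p s).ζ j (s.init.Ω (j + 1))ᶜ ω' :=
    fun _ hj ω ω' h => hloc.localLaws₂.zeta0_local_lt hj _ ω ω' h
  -- 12a's A-side factor reads scales `j`, `j+1`; the residual's `quad_j` is `k`-local by `hqloc` ⇒ `w_j` is `k`-local, `j < k`
  have hwloc : ∀ (S : ℕ → Set (Site (F.P p.K) 0)) (j : ℕ), j < k → ∀ ω ω' : MultiCfg (F.P p.K) (SU N) (FluctV N), (∀ i, i ≤ k → ω i = ω' i) →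
      (WtOfRecord₁₃H F N θ p s).w j (s.init.Λ (j + 1)) ((s.init.Λ (j + 1))ᶜ ∩ s.init.Ω (j + 1)) (S (j + 1)) ω =
        (WtOfRecord₁₃H F N θ p s).w j (s.init.Λ (j + 1)) ((s.init.Λ (j + 1))ᶜ ∩ s.init.Ω (j + 1)) (S (j + 1)) ω' :=
    fun S j hj ω ω' h => tkWeightsOfRecordP_w_local_of_quad_local (θ.zhAt p s) hj _ _ _ (hqloc j hj) ω ω' h
  -- (V) the generation-`k` ζ-spec with the old front factor
  have hζχ : ∀ U₀ : GaugeField (F.P p.K) k (SU N),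
      (WtOfRecord₁₃H F N θ p s).ζ k Set.univ (pairCfgAt (V := FluctV N) k ((avOfRecord F N p.K k).avg U₀) U₀) *
          (WtOfRecord₁₃H F N θ p s).w k ∅ ∅ ∅ (pairCfgAt (V := FluctV N) k ((avOfRecord F N p.K k).avg U₀) U₀) =
        chiSeqOfRecord F N θ.ν θ.τ9.M (gOfRecord₁₃ F N θ.toStage13Params p) p.K k s.init U₀ *
          wOfRecord₉ F N θ.toStage9Params p (gOfRecord₁₃ F N θ.toStage13Params p) k s U₀ ((avOfRecord F N p.K k).avg U₀) := by
    intro U₀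
    rw [WtOfRecord₁₃H_eq_tkWeightsOfRecordP, tkWeightsOfRecordP_ζ_apply, tkWeightsOfRecordP_w_empty, hq, mul_zero, Real.exp_zero, mul_one]
    exact hZ _ _
  exact clause_succ_of_Omega_empty_of_prefix_of_clause_of_graph θ.toStage13Params p hk hM s hΩ (WtOfRecord₁₃H F N θ p s)
    (WtOfRecord₁₃H F N θ p s.init) hpre' hζloc hwloc (θ.rzAt p s.init) (θ.rzAt p s) t E₀ hA hid hζχ hI

/-- **… keyed on def-T's v1.7 core provisos** (`zhLocal` supplies `hloc`). [cite: Balaban1988Convergent, Theorem p.245, (3.24)–(3.25) p.270, (3.2)–(3.9) pp.265–266] -/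
theorem clause_succ_CoPH_of_Omega_empty_of_pinChi_of_provisos_of_clause_of_graph (h : θ.Provisos₁₃CoPH F N) {k : ℕ} (hk : k < p.K) (hM : 1 ≤ θ.τ9.M)
    (s : SeqOfRecord F θ.ν θ.τ9.M (gOfRecord₁₃ F N θ.toStage13Params p) p.K (k + 1)) (hΩ : s.Ω (k + 1) = ∅)
    (hqloc : ∀ j, j < k → ∀ ω ω' : MultiCfg (F.P p.K) (SU N) (FluctV N), (∀ i, i ≤ k → ω i = ω' i) →
      (θ.zhAt p s).quad j (s.init.Λ (j + 1)) ω = (θ.zhAt p s).quad j (s.init.Λ (j + 1)) ω')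
    (hpre : ∀ j, j < k → (θ.zhAt p s).ζ0 j = (θ.zhAt p s.init).ζ0 j ∧ (θ.zhAt p s).quad j = (θ.zhAt p s.init).quad j)
    (t : Sect2.TermValues (F.P p.K) (MatA N) (FluctV N) θ.τ9.M) (E₀ : ℝ)
    (hA : ∀ (S : ℕ → Set (Site (F.P p.K) 0)) (a a' : Tk.MSFluct (F.P p.K) (FluctV N)) (Uf : GaugeField (F.P p.K) 0 (SU N)), (∀ i, i ≤ k → a i = a' i) →
      (sect2ActionDataOfRecord F N (FluctV N) p.K (settingOfRecord₁₃ F N θ.toStage13Params p) (θ.rzAt p s.init) s.init t (S, a) E₀).action23 k Uf =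
        (sect2ActionDataOfRecord F N (FluctV N) p.K (settingOfRecord₁₃ F N θ.toStage13Params p) (θ.rzAt p s.init) s.init t (S, a') E₀).action23 k Uf)
    (hid : slotsOfRecord F N θ.ν θ.τ9 (EOfRecord₁₃ F N θ.toStage13Params) (wOfRecord₉ F N θ.toStage9Params) θ.ppSel p
        (gOfRecord₁₃ F N θ.toStage13Params p) k s.init = 0 ∨
      ∀ᵐ U₀ ∂fieldMeasure (F.P p.K) k (SU N),
        chiSeqOfRecord F N θ.ν θ.τ9.M (gOfRecord₁₃ F N θ.toStage13Params p) p.K k s.init U₀ ≠ 0 →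
          slotsOfRecord F N θ.ν θ.τ9 (EOfRecord₁₃ F N θ.toStage13Params) (wOfRecord₉ F N θ.toStage9Params) θ.ppSel p
              (gOfRecord₁₃ F N θ.toStage13Params p) k s.init U₀ =
            sect2Slot F N (FluctV N) p.K (settingOfRecord₁₃ F N θ.toStage13Params p) (θ.rzAt p s.init) (WtOfRecord₁₃H F N θ p s.init) s.init t E₀
              (UbgOfRecord₁₃CoP F N θ.toStage13Params p k s.init) U₀)
    (hZ : ∀ (V' : GaugeField (F.P p.K) (k + 1) (SU N)) (U₀ : GaugeField (F.P p.K) k (SU N)),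
      (θ.zhAt p s).ζ0 k Set.univ (pairCfgAt (V := FluctV N) k V' U₀) =
        chiSeqOfRecord F N θ.ν θ.τ9.M (gOfRecord₁₃ F N θ.toStage13Params p) p.K k s.init U₀ *
          wOfRecord₉ F N θ.toStage9Params p (gOfRecord₁₃ F N θ.toStage13Params p) k s U₀ ((avOfRecord F N p.K k).avg U₀))
    (hq : ∀ (V' : GaugeField (F.P p.K) (k + 1) (SU N)) (U₀ : GaugeField (F.P p.K) k (SU N)), (θ.zhAt p s).quad k ∅ (pairCfgAt (V := FluctV N) k V' U₀) = 0)
    (hI : ∀ S ∈ admSOfRecord F θ.ν θ.τ9.M (gOfRecord₁₃ F N θ.toStage13Params p) p.K k s.init,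
      Integrable (fun U₀ : GaugeField (F.P p.K) k (SU N) => noExpIntegrandAt F N (FluctV N) p.K k (WtOfRecord₁₃H F N θ p s)
        (tkBranchOfRecord F N (FluctV N) θ.ν θ.τ9.M _ p.K (WtOfRecord₁₃H F N θ p s) s.init S k
          (fun ω => sect2Operand F N (FluctV N) p.K (settingOfRecord₁₃ F N θ.toStage13Params p) (θ.rzAt p s) s t E₀
            (UbgOfRecord₁₃CoP F N θ.toStage13Params p (k + 1) s) (S, fun j => (ω j).2) (fun j => (ω j).1)))
        ((avOfRecord F N p.K k).avg U₀) U₀) (fieldMeasure (F.P p.K) k (SU N))) :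
    slotsTOfRecord F N θ.ν θ.τ9 (EOfRecord₁₃ F N θ.toStage13Params) (wOfRecord₉ F N θ.toStage9Params) θ.ppSel p
        (gOfRecord₁₃ F N θ.toStage13Params p) (k + 1) s = 0 ∨
      ∀ᵐ V' ∂fieldMeasure (F.P p.K) (k + 1) (SU N),
        chiSeqOfRecord F N θ.ν θ.τ9.M (gOfRecord₁₃ F N θ.toStage13Params p) p.K (k + 1) s V' ≠ 0 →
          slotsTOfRecord F N θ.ν θ.τ9 (EOfRecord₁₃ F N θ.toStage13Params) (wOfRecord₉ F N θ.toStage9Params) θ.ppSel p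
              (gOfRecord₁₃ F N θ.toStage13Params p) (k + 1) s V' =
            sect2Slot F N (FluctV N) p.K (settingOfRecord₁₃ F N θ.toStage13Params p) (θ.rzAt p s) (WtOfRecord₁₃H F N θ p s) s t E₀
              (UbgOfRecord₁₃CoP F N θ.toStage13Params p (k + 1) s) V' :=
  clause_succ_CoPH_of_Omega_empty_of_pinChi_of_clause_of_graph θ p hk hM s hΩ (h.zhLocal p (k + 1) s.Ω s.Λ) hqloc hpre t E₀ hA hid hZ hq hI


/-! ## §2  ★★ The OLD-BRANCH form (p547524 ∕ p563293) with INTEGRABILITY `hIB` of the old branch ALONE (`hmB` DROPPED) -/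

/-- **★★ THE GENERAL-HISTORY 𝐓-STEP AT THE v1.7 RECORD, OLD-BRANCH FORM** (p544575's provisos-keyed theorem with the measurability ∕ bound asked of the OLD branch
`U ↦ 𝐓_k(init s′, S)[e^{A_k(init s′)}](U)` only): `hid` at `init s′` ⇒ the 𝐓-image clause at `s′`, same `t`, same `E₀`, under (P) `hpre`, (V) `hZ`+`hq`, `hqloc`, `hA`,
`hIB` ALONE (`k < K`, `1 ≤ M`, `Provisos₁₃CoPH`; p563293's `hmB` DROPPED — its only use was the joint measurability of the new integrand, now read off the graph). [cite: Balaban1988Convergent, Theorem p.245, (3.24)–(3.25) p.270, (2.18) p.257, (2.20)–(2.25) pp.258–259, (3.16) p.268] -/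
theorem clause_succ_CoPH_of_Omega_empty_of_pinChi_of_oldBranch_of_clause_of_graph (h : θ.Provisos₁₃CoPH F N) {k : ℕ} (hk : k < p.K) (hM : 1 ≤ θ.τ9.M)
    (s : SeqOfRecord F θ.ν θ.τ9.M (gOfRecord₁₃ F N θ.toStage13Params p) p.K (k + 1)) (hΩ : s.Ω (k + 1) = ∅)
    (hqloc : ∀ j, j < k → ∀ ω ω' : MultiCfg (F.P p.K) (SU N) (FluctV N), (∀ i, i ≤ k → ω i = ω' i) →
      (θ.zhAt p s).quad j (s.init.Λ (j + 1)) ω = (θ.zhAt p s).quad j (s.init.Λ (j + 1)) ω')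
    (hpre : ∀ j, j < k → (θ.zhAt p s).ζ0 j = (θ.zhAt p s.init).ζ0 j ∧ (θ.zhAt p s).quad j = (θ.zhAt p s.init).quad j)
    (t : Sect2.TermValues (F.P p.K) (MatA N) (FluctV N) θ.τ9.M) (E₀ : ℝ)
    (hA : ∀ (S : ℕ → Set (Site (F.P p.K) 0)) (a a' : Tk.MSFluct (F.P p.K) (FluctV N)) (Uf : GaugeField (F.P p.K) 0 (SU N)), (∀ i, i ≤ k → a i = a' i) →
      (sect2ActionDataOfRecord F N (FluctV N) p.K (settingOfRecord₁₃ F N θ.toStage13Params p) (θ.rzAt p s.init) s.init t (S, a) E₀).action23 k Uf =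
        (sect2ActionDataOfRecord F N (FluctV N) p.K (settingOfRecord₁₃ F N θ.toStage13Params p) (θ.rzAt p s.init) s.init t (S, a') E₀).action23 k Uf)
    (hid : slotsOfRecord F N θ.ν θ.τ9 (EOfRecord₁₃ F N θ.toStage13Params) (wOfRecord₉ F N θ.toStage9Params) θ.ppSel p
        (gOfRecord₁₃ F N θ.toStage13Params p) k s.init = 0 ∨
      ∀ᵐ U₀ ∂fieldMeasure (F.P p.K) k (SU N),
        chiSeqOfRecord F N θ.ν θ.τ9.M (gOfRecord₁₃ F N θ.toStage13Params p) p.K k s.init U₀ ≠ 0 →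
          slotsOfRecord F N θ.ν θ.τ9 (EOfRecord₁₃ F N θ.toStage13Params) (wOfRecord₉ F N θ.toStage9Params) θ.ppSel p
              (gOfRecord₁₃ F N θ.toStage13Params p) k s.init U₀ =
            sect2Slot F N (FluctV N) p.K (settingOfRecord₁₃ F N θ.toStage13Params p) (θ.rzAt p s.init) (WtOfRecord₁₃H F N θ p s.init) s.init t E₀
              (UbgOfRecord₁₃CoP F N θ.toStage13Params p k s.init) U₀)
    (hZ : ∀ (V' : GaugeField (F.P p.K) (k + 1) (SU N)) (U₀ : GaugeField (F.P p.K) k (SU N)),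
      (θ.zhAt p s).ζ0 k Set.univ (pairCfgAt (V := FluctV N) k V' U₀) =
        chiSeqOfRecord F N θ.ν θ.τ9.M (gOfRecord₁₃ F N θ.toStage13Params p) p.K k s.init U₀ *
          wOfRecord₉ F N θ.toStage9Params p (gOfRecord₁₃ F N θ.toStage13Params p) k s U₀ ((avOfRecord F N p.K k).avg U₀))
    (hq : ∀ (V' : GaugeField (F.P p.K) (k + 1) (SU N)) (U₀ : GaugeField (F.P p.K) k (SU N)), (θ.zhAt p s).quad k ∅ (pairCfgAt (V := FluctV N) k V' U₀) = 0)
    (hIB : ∀ S ∈ admSOfRecord F θ.ν θ.τ9.M (gOfRecord₁₃ F N θ.toStage13Params p) p.K k s.init,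
      Integrable (fun U₀ : GaugeField (F.P p.K) k (SU N) =>
        tkBranchOfRecord F N (FluctV N) θ.ν θ.τ9.M _ p.K (WtOfRecord₁₃H F N θ p s) s.init S k
          (fun ω => sect2Operand F N (FluctV N) p.K (settingOfRecord₁₃ F N θ.toStage13Params p) (θ.rzAt p s.init) s.init t E₀
            (UbgOfRecord₁₃CoP F N θ.toStage13Params p k s.init) (S, fun j => (ω j).2) (fun j => (ω j).1))
          (baseCfg (V := FluctV N) k U₀)) (fieldMeasure (F.P p.K) k (SU N))) :
    slotsTOfRecord F N θ.ν θ.τ9 (EOfRecord₁₃ F N θ.toStage13Params) (wOfRecord₉ F N θ.toStage9Params) θ.ppSel p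
        (gOfRecord₁₃ F N θ.toStage13Params p) (k + 1) s = 0 ∨
      ∀ᵐ V' ∂fieldMeasure (F.P p.K) (k + 1) (SU N),
        chiSeqOfRecord F N θ.ν θ.τ9.M (gOfRecord₁₃ F N θ.toStage13Params p) p.K (k + 1) s V' ≠ 0 →
          slotsTOfRecord F N θ.ν θ.τ9 (EOfRecord₁₃ F N θ.toStage13Params) (wOfRecord₉ F N θ.toStage9Params) θ.ppSel p
              (gOfRecord₁₃ F N θ.toStage13Params p) (k + 1) s V' =
            sect2Slot F N (FluctV N) p.K (settingOfRecord₁₃ F N θ.toStage13Params p) (θ.rzAt p s) (WtOfRecord₁₃H F N θ p s) s t E₀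
              (UbgOfRecord₁₃CoP F N θ.toStage13Params p (k + 1) s) V' := by
  -- abbreviations: the old front factor, the graph step weight, the old branch
  set χk : GaugeField (F.P p.K) k (SU N) → ℝ := chiSeqOfRecord F N θ.ν θ.τ9.M (gOfRecord₁₃ F N θ.toStage13Params p) p.K k s.init with hχk
  set wg : GaugeField (F.P p.K) k (SU N) → ℝ := fun U₀ =>
    wOfRecord₉ F N θ.toStage9Params p (gOfRecord₁₃ F N θ.toStage13Params p) k s U₀ ((avOfRecord F N p.K k).avg U₀) with hwg
  have hχm : Measurable χk := measurable_chiSeqOfRecord_init θ p h hk s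
  have hwm : Measurable wg := by
    have hg : Measurable fun U₀ : GaugeField (F.P p.K) k (SU N) => ((avOfRecord F N p.K k).avg U₀, U₀) :=
      (avOfRecord_measurable F N p.K k).prodMk measurable_id
    simpa only [hwg, Function.comp_def] using ((h.tstep p k hk).measW s).comp hg
  -- the closed form of the new integrand per old branch
  have hnew : ∀ (S : ℕ → Set (Site (F.P p.K) 0)) (V' : GaugeField (F.P p.K) (k + 1) (SU N)) (U₀ : GaugeField (F.P p.K) k (SU N)),
      noExpIntegrandAt F N (FluctV N) p.K k (WtOfRecord₁₃H F N θ p s)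
          (tkBranchOfRecord F N (FluctV N) θ.ν θ.τ9.M _ p.K (WtOfRecord₁₃H F N θ p s) s.init S k
            (fun ω => sect2Operand F N (FluctV N) p.K (settingOfRecord₁₃ F N θ.toStage13Params p) (θ.rzAt p s) s t E₀
              (UbgOfRecord₁₃CoP F N θ.toStage13Params p (k + 1) s) (S, fun j => (ω j).2) (fun j => (ω j).1)))
          V' U₀ =
        χk U₀ * wg U₀ *
          tkBranchOfRecord F N (FluctV N) θ.ν θ.τ9.M _ p.K (WtOfRecord₁₃H F N θ p s) s.init S k
            (fun ω => sect2Operand F N (FluctV N) p.K (settingOfRecord₁₃ F N θ.toStage13Params p) (θ.rzAt p s.init) s.init t E₀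
              (UbgOfRecord₁₃CoP F N θ.toStage13Params p k s.init) (S, fun j => (ω j).2) (fun j => (ω j).1))
            (baseCfg (V := FluctV N) k U₀) := fun S V' U₀ =>
    newIntegrand_eq_of_pinChi θ p hM s hΩ (h.zhLocal p (k + 1) s.Ω s.Λ) hqloc t E₀ S (hA S) hZ hq V' U₀
  refine clause_succ_CoPH_of_Omega_empty_of_pinChi_of_provisos_of_clause_of_graph θ p h hk hM s hΩ hqloc hpre t E₀ hA hid hZ hq
    (fun S hS => ?_)
  · -- graph-integrability: `|χ·w| ≤ 1` times the integrable old branch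
    have heq : (fun U₀ : GaugeField (F.P p.K) k (SU N) => noExpIntegrandAt F N (FluctV N) p.K k (WtOfRecord₁₃H F N θ p s)
        (tkBranchOfRecord F N (FluctV N) θ.ν θ.τ9.M _ p.K (WtOfRecord₁₃H F N θ p s) s.init S k
          (fun ω => sect2Operand F N (FluctV N) p.K (settingOfRecord₁₃ F N θ.toStage13Params p) (θ.rzAt p s) s t E₀
            (UbgOfRecord₁₃CoP F N θ.toStage13Params p (k + 1) s) (S, fun j => (ω j).2) (fun j => (ω j).1)))
        ((avOfRecord F N p.K k).avg U₀) U₀) =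
        fun U₀ => tkBranchOfRecord F N (FluctV N) θ.ν θ.τ9.M _ p.K (WtOfRecord₁₃H F N θ p s) s.init S k
            (fun ω => sect2Operand F N (FluctV N) p.K (settingOfRecord₁₃ F N θ.toStage13Params p) (θ.rzAt p s.init) s.init t E₀
              (UbgOfRecord₁₃CoP F N θ.toStage13Params p k s.init) (S, fun j => (ω j).2) (fun j => (ω j).1))
            (baseCfg (V := FluctV N) k U₀) * (χk U₀ * wg U₀) := by
      funext U₀
      rw [hnew S _ U₀]
      ring
    rw [heq]
    refine (hIB S hS).mul_bdd (hχm.mul hwm).aestronglyMeasurable (c := 1) (Filter.Eventually.of_forall fun U₀ => ?_)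
    rw [Real.norm_eq_abs, abs_mul]
    have h1 : |χk U₀| ≤ 1 := abs_chiSeqOfRecord_le_one F N θ.ν θ.τ9.M _ p.K k s.init U₀
    have h2 : |wg U₀| ≤ 1 := (h.tstep p k hk).absW_le s U₀ _
    calc |χk U₀| * |wg U₀| ≤ 1 * 1 := mul_le_mul h1 h2 (abs_nonneg _) zero_le_one
      _ = 1 := one_mul 1

end CoPH

/-! ## §3  ★★★ At the re-pinned parameter `rePinH θ` (p553094 §3 ∕ p569094's first theorem) with `hmB` DROPPED -/

section RePinned

variable (θ : Stage13HParams F N) (p : B12.RunParams)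

/-- **★★★ THE GENERAL-HISTORY NO-EXPANSION 𝐓-STEP AT THE RE-PINNED PARAMETER, OLD-BRANCH FORM, UNDER INTEGRABILITY OF THE OLD BRANCHES ALONE** (p569094's
`clause_succ_rePinH_of_Omega_empty_of_oldBranch_of_clause_of_integrable` with the measurability binder `hmB` DROPPED): (P), (V), `hq`, `hqloc` discharged at `rePinH θ`
(p552185's faces); remaining displayed binders = the locality `hA` (eliminated per witness by the sibling file `…N11FluctTruncation`) and `hIB`.
[cite: Balaban1988Convergent, Theorem p.245, (3.24)–(3.25) p.270, (2.18) p.257, (2.20)–(2.25) pp.258–259, (3.16) p.268] -/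
theorem clause_succ_rePinH_of_Omega_empty_of_oldBranch_of_clause_of_graph (h : θ.Provisos₁₃CoPH F N) {k : ℕ} (hk : k < p.K) (hM : 1 ≤ θ.τ9.M)
    (s : SeqOfRecord F θ.ν θ.τ9.M (gOfRecord₁₃ F N θ.toStage13Params p) p.K (k + 1)) (hΩ : s.Ω (k + 1) = ∅)
    (t : Sect2.TermValues (F.P p.K) (MatA N) (FluctV N) θ.τ9.M) (E₀ : ℝ)
    (hA : ∀ (S : ℕ → Set (Site (F.P p.K) 0)) (a a' : Tk.MSFluct (F.P p.K) (FluctV N)) (Uf : GaugeField (F.P p.K) 0 (SU N)), (∀ i, i ≤ k → a i = a' i) →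
      (sect2ActionDataOfRecord F N (FluctV N) p.K (settingOfRecord₁₃ F N θ.toStage13Params p) (θ.rzAt p s.init) s.init t (S, a) E₀).action23 k Uf =
        (sect2ActionDataOfRecord F N (FluctV N) p.K (settingOfRecord₁₃ F N θ.toStage13Params p) (θ.rzAt p s.init) s.init t (S, a') E₀).action23 k Uf)
    (hid : slotsOfRecord F N θ.ν θ.τ9 (EOfRecord₁₃ F N θ.toStage13Params) (wOfRecord₉ F N θ.toStage9Params) θ.ppSel p
        (gOfRecord₁₃ F N θ.toStage13Params p) k s.init = 0 ∨
      ∀ᵐ U₀ ∂fieldMeasure (F.P p.K) k (SU N),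
        chiSeqOfRecord F N θ.ν θ.τ9.M (gOfRecord₁₃ F N θ.toStage13Params p) p.K k s.init U₀ ≠ 0 →
          slotsOfRecord F N θ.ν θ.τ9 (EOfRecord₁₃ F N θ.toStage13Params) (wOfRecord₉ F N θ.toStage9Params) θ.ppSel p
              (gOfRecord₁₃ F N θ.toStage13Params p) k s.init U₀ =
            sect2Slot F N (FluctV N) p.K (settingOfRecord₁₃ F N θ.toStage13Params p) (θ.rzAt p s.init) (WtOfRecord₁₃H F N (rePinH θ) p s.init) s.init t E₀
              (UbgOfRecord₁₃CoP F N θ.toStage13Params p k s.init) U₀)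
    (hIB : ∀ S ∈ admSOfRecord F θ.ν θ.τ9.M (gOfRecord₁₃ F N θ.toStage13Params p) p.K k s.init,
      Integrable (fun U₀ : GaugeField (F.P p.K) k (SU N) =>
        tkBranchOfRecord F N (FluctV N) θ.ν θ.τ9.M _ p.K (WtOfRecord₁₃H F N (rePinH θ) p s) s.init S k
          (fun ω => sect2Operand F N (FluctV N) p.K (settingOfRecord₁₃ F N θ.toStage13Params p) (θ.rzAt p s.init) s.init t E₀
            (UbgOfRecord₁₃CoP F N θ.toStage13Params p k s.init) (S, fun j => (ω j).2) (fun j => (ω j).1))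
          (baseCfg (V := FluctV N) k U₀)) (fieldMeasure (F.P p.K) k (SU N))) :
    slotsTOfRecord F N θ.ν θ.τ9 (EOfRecord₁₃ F N θ.toStage13Params) (wOfRecord₉ F N θ.toStage9Params) θ.ppSel p
        (gOfRecord₁₃ F N θ.toStage13Params p) (k + 1) s = 0 ∨
      ∀ᵐ V' ∂fieldMeasure (F.P p.K) (k + 1) (SU N),
        chiSeqOfRecord F N θ.ν θ.τ9.M (gOfRecord₁₃ F N θ.toStage13Params p) p.K (k + 1) s V' ≠ 0 →
          slotsTOfRecord F N θ.ν θ.τ9 (EOfRecord₁₃ F N θ.toStage13Params) (wOfRecord₉ F N θ.toStage9Params) θ.ppSel p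
              (gOfRecord₁₃ F N θ.toStage13Params p) (k + 1) s V' =
            sect2Slot F N (FluctV N) p.K (settingOfRecord₁₃ F N θ.toStage13Params p) (θ.rzAt p s) (WtOfRecord₁₃H F N (rePinH θ) p s) s t E₀
              (UbgOfRecord₁₃CoP F N θ.toStage13Params p (k + 1) s) V' :=
  clause_succ_CoPH_of_Omega_empty_of_pinChi_of_oldBranch_of_clause_of_graph (rePinH θ) p (provisos₁₃CoPH_rePinH h) hk hM s hΩ
    (fun _ _ _ _ _ => rfl) (prefix_agree_rePinH θ p s hΩ) t E₀ hA hid (zhAt_rePinH_ζ0_univ_pairCfgAt θ p hk s hΩ) (fun _ _ => rfl) hIB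

end RePinned


end Summit.QuantumFields.YangMills.Theorems.BalabanUVNodesN11NoExpansionOldBranchGraph

end
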